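import Summits.QuantumFields.YangMills.Theorems.BalabanUVNodesN09CentralWindowInverseContinuous
import Summits.QuantumFields.YangMills.Theorems.BalabanUVNodesN09TowerBasePointOfPerBondCharts
import Summits.QuantumFields.YangMills.Theorems.BalabanUVNodesN09TransportPositiveOnDomainOfFibredChart

/-!
# NODE N09 [B12] — THE TWO BASE-POINT SOCKETS `hΦc`, `hJpos` OF THE ROAD-A′ TOWER FROM PARAMETRIC OPENNESS OF THE IMAGE WINDOWS AT THE CRITICAL CONFIGURATION

Cell `pub-ymgap` (YM-PLAN Track A), width seat `pub-ymgap-dag-n09-w6` g4, FILE 3; helper of K1⁹ `StabilityBRunRowsAtRecordR13SepCoPHV` = stmt-QuantumFields-27364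
(`--supports`, `--as helper`, count-neutral).  [I] = [Balaban1987RG1].  CONSUMED BY NAME (nothing modified): this seat's FILE 2 `…N09CentralWindowInverseContinuous`
(★★★ `continuousOn_triChart_of_leftInverse_record`: road A′'s triangular chart is JOINTLY continuous on the joint image graph — closed graph + compact fibre), dag-n09-w5 g4's
`…N09TowerChartOfPerBondCharts` (`towerChart_eq_of_mem`) and `…N09TowerBasePointOfPerBondCharts` (★★ `triChart_critCfg_eq`: `Φ_tri(V, V^{(j)}(V)) = V^{(j)}(V)`), this seat's g3
`…N09HregOfPerBondChartsAtRecord.avOfRecord_triChart_eq_of_jacobian_ne_zero` (support-form fibre identity from `hright`), dag-n09-w4's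
`…N09TransportPositiveOnDomainOfFibredChart.fluctDevOfRecord_eq_of_avg_eq`, K0e∕def-χ's `Node00.chiFix29OfRecord_eq_one_iff`.

WHY.  dag-n09-w5 g4's tower `…N09TowerOfPerBondCharts.hreg_pos_all_of_perBondCharts_centralWindow` leaves displayed, per step `j < K`, EXACTLY four continuity sockets of
dag-n09-w1's regularity tower at the re-based road-A′ chart `(Φ′, J′)`: `hΦV`, `hJV` (a.e.-`z` continuity in the coarse field) and the two BASE-POINT sockets
`hΦc : ContinuousAt (z ↦ Φ′(V, z)) (V^{(j)}(V))`, `hJpos : ∀ᶠ z in 𝓝 (V^{(j)}(V)), 0 < J′(V, z)` (`V ∈ domAlt_{j+1}`).  THIS FILE discharges the two base-point sockets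
MODULO two located inputs, both about the point `(V, V^{(j)}(V))` only: (O) PARAMETRIC OPENNESS of the image windows — `{z | V c ∈ T_c(z)} ∈ 𝓝 (V^{(j)}(V))` for every coarse
bond `c` (the implicit-function face of the one-bond (0.4) average; dag-n09-w4 g5's C^ω one-bond chart reads ∕ global forward law are its natural supplier); (P) the inverse
densities do not vanish on the image windows (`jd_c(z, v) ≠ 0` for `v ∈ T_c(z)` — immediate for the Lusin–Souslin data `jd = (jac ∘ ϑ)⁻¹` of dag-n09-w6 g3 once exported).
Given (O)(P): for `z` near `V^{(j)}(V)` every image window contains `V c`, so `J_tri(V, z) ≠ 0` and (right-inverse clause) the triangular chart lies over `V`; its fluctuation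
variables then read `dist1 (V^{(j)}(V)(b)⁻¹ · Φ_tri(V,z)(b))`, continuous in `z` by FILE 2 and `= 0 < ε₁` at the base point (dag-n09-w5's `Φ_tri(V, V^{(j)}(V)) = V^{(j)}(V)`), so
`χ^{(2.9)}_j(Φ_tri(V,z)) = 1` near the base point ((R′), §3); hence the `z`-section of the rebase set `A = {J_tri ≠ 0} ∩ Φ_tri⁻¹{χ ≠ 0}` is a NEIGHBOURHOOD of `V^{(j)}(V)` (§1), on it
`Φ′ = Φ_tri` (continuous there) and `J′ = J_tri > 0` — so `hΦc` and `hJpos` hold (§2), read at the record in the tower's binder shapes VERBATIM (§3).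

CONTENT (theorems only; 0 `def`, 0 `instance`, 0 `notation`, 0 `sorry`).  §1 `indicator_pos_of_mem_of_ne_zero` · `jacobianTri_ne_zero_of_forall_mem` · ★ `rebaseSection_mem_nhds_of_openness` ·
`continuousAt_triChart_env_of_openness`; §2 (general fallback `σ`, support set `R`) ★★ `towerChart_continuousAt_of_openness` · ★★ `towerJacobian_eventually_pos_of_openness`; §3 at the
record ★ `eventually_chiFixed29_triChart_ne_zero_of_openness` ((R′) from `hright` + `0 < ε₁`) · ★★★ `tower_hΦc_of_openness_of_hsolν_of_numerics` · ★★★ `tower_hJpos_of_openness_of_hsolν_of_numerics`.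

HONEST FRAMING.  Count-neutral topology∕bookkeeping BY NAME; (O), (P), `hT`∕`hleft`∕`hright`, `0 < ε₁`, `hsolν` and the numerics stay DISPLAYED hypotheses, asserted of NO record; `hΦV`∕`hJV`
(the a.e. sockets) NOT touched; NO Jacobian law, NO nullity; nothing of Bałaban's estimates asserted; `hreg` NOT discharged; N09 NOT discharged; conjunct 1 (Lemma 4) ∕ FLAG №7
untouched; K0⁷ ∕ K1⁹ ∕ K3⁸ NOT closed; counts unmoved (typed 28∕28 · discharged 5∕28); no summit statement is proved by this seat; one finite four-torus programme at fixed `ε` — R4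
closes the conditional rung `BalabanLadder.UV` only; NOT continuum ∕ ℝ⁴ ∕ OS; the Yang–Mills mass gap (Clay) is NOT proved by any of this.
-/

noncomputable section

namespace Summit.QuantumFields.YangMills.BalabanUVNodes.N09TowerBasePointSocketsOfOpenness

open MeasureTheory Set Function Filter Topology
open scoped ENNReal NNReal
open Literature.MathematicalPhysics.QuantumFieldTheory.Balaban1983to89
open Literature.MathematicalPhysics.QuantumFieldTheory.Balaban1983to89.T4Continuum (T4Family)
open Literature.MathematicalPhysics.QuantumFieldTheory.Balaban1983to89.BlockAveraging (Idx)
open Literature.MathematicalPhysics.QuantumFieldTheory.Balaban1983to89.BlockAveragingHaarAC (centralBond pre post)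
open Literature.MathematicalPhysics.QuantumFieldTheory.Balaban1983to89.BlockAveragingEMLHaarAC (fibreFamily)
open Literature.MathematicalPhysics.QuantumFieldTheory.Balaban1983to89.ExpMeanLog (deltaSU)
open Literature.MathematicalPhysics.QuantumFieldTheory.Balaban1983to89.Node00
open Summit.QuantumFields.YangMills.BalabanUVNodes.N09CentralWindowInverseContinuous (continuousOn_triChart_of_leftInverse_record)
open Summit.QuantumFields.YangMills.BalabanUVNodes.N09TowerChartOfPerBondCharts (towerChart_eq_of_mem)
open Summit.QuantumFields.YangMills.BalabanUVNodes.N09TowerBasePointOfPerBondCharts (triChart_critCfg_eq)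
open Summit.QuantumFields.YangMills.BalabanUVNodes.N09HregOfPerBondChartsAtRecord (avOfRecord_triChart_eq_of_jacobian_ne_zero)
open Summit.QuantumFields.YangMills.BalabanUVNodes.N09TransportPositiveOnDomainOfFibredChart (fluctDevOfRecord_eq_of_avg_eq)

variable {F : T4Family} {N : ℕ} [NeZero N] {K j : ℕ}
  (T : PBond (F.P K) (j + 1) → GaugeField (F.P K) j (SU N) → Set (SU N))
  (ϑ : PBond (F.P K) (j + 1) → GaugeField (F.P K) j (SU N) → SU N → SU N)
  (jd : PBond (F.P K) (j + 1) → GaugeField (F.P K) j (SU N) → SU N → ℝ≥0)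

/-! ## §1  The `z`-section of the rebase set is a neighbourhood of the base point -/

omit [NeZero N] in
/-- An `ℝ≥0`-valued indicator is positive at a point of the set where the function does not vanish (bookkeeping). [cite: Balaban1987RG1, (2.10) p.267 (bookkeeping)] -/
theorem indicator_pos_of_mem_of_ne_zero {X : Type*} {s : Set X} {f : X → ℝ≥0} {x : X} (hx : x ∈ s) (hf : f x ≠ 0) :
    0 < s.indicator f x := by
  rw [Set.indicator_of_mem hx]
  exact pos_iff_ne_zero.2 hf

omit [NeZero N] in
/-- On the joint image graph road A′'s Jacobian `J_tri = 𝟙{∀ c, V c ∈ T_c(z)} · ∏_c jd_c(z, V c)` does not vanish, as soon as the inverse densities do not vanish on the image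
windows ((P)). [cite: Balaban1987RG1, (2.10) p.267 (bookkeeping)] -/
theorem jacobianTri_ne_zero_of_forall_mem (hjd0 : ∀ c z v, v ∈ T c z → jd c z v ≠ 0)
    {p : (PBond (F.P K) (j + 1) → SU N) × GaugeField (F.P K) j (SU N)} (hp : ∀ c, p.1 c ∈ T c p.2) :
    {q : (PBond (F.P K) (j + 1) → SU N) × GaugeField (F.P K) j (SU N) | ∀ c, q.1 c ∈ T c q.2}.indicator (fun q => ∏ c, jd c q.2 (q.1 c)) p ≠ 0 := by
  rw [Set.indicator_of_mem (show p ∈ {q : (PBond (F.P K) (j + 1) → SU N) × GaugeField (F.P K) j (SU N) | ∀ c, q.1 c ∈ T c q.2} from hp)]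
  exact Finset.prod_ne_zero_iff.2 fun c _ => hjd0 c p.2 (p.1 c) (hp c)

omit [NeZero N] in
/-- ★ **THE `z`-SECTION OF THE REBASE SET IS A NEIGHBOURHOOD OF THE BASE POINT.**  Per-bond data `(T, ϑ, jd)`, a coarse field `V`, a base point `z₀`, a set `R` of fine
fields.  IF (O) every image window contains `V c` for all `z` near `z₀`, (P) the inverse densities do not vanish on the image windows, and (R′) the triangular chart stays in `R`
for `z` near `z₀`, THEN `{z | (V, z) ∈ A} ∈ 𝓝 z₀` for the rebase set `A = {J_tri ≠ 0} ∩ Φ_tri⁻¹ R` (finitely many bonds: `eventually_all`).  No continuity is used here.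
[cite: Balaban1987RG1, (2.10) p.267 and (2.3) p.265 (bookkeeping)] -/
theorem rebaseSection_mem_nhds_of_openness (hjd0 : ∀ c z v, v ∈ T c z → jd c z v ≠ 0) (R : Set (GaugeField (F.P K) j (SU N)))
    {V : PBond (F.P K) (j + 1) → SU N} {z₀ : GaugeField (F.P K) j (SU N)}
    (hopen : ∀ c, {z : GaugeField (F.P K) j (SU N) | V c ∈ T c z} ∈ 𝓝 z₀)
    (hRev : ∀ᶠ z in 𝓝 z₀, (extend centralBond (fun c => ϑ c z (V c)) z : GaugeField (F.P K) j (SU N)) ∈ R) :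
    {z : GaugeField (F.P K) j (SU N) | (V, z) ∈ {p : (PBond (F.P K) (j + 1) → SU N) × GaugeField (F.P K) j (SU N) |
        {q : (PBond (F.P K) (j + 1) → SU N) × GaugeField (F.P K) j (SU N) | ∀ c, q.1 c ∈ T c q.2}.indicator (fun q => ∏ c, jd c q.2 (q.1 c)) p ≠ 0 ∧
          (extend centralBond (fun c => ϑ c p.2 (p.1 c)) p.2 : GaugeField (F.P K) j (SU N)) ∈ R}} ∈ 𝓝 z₀ := by
  have hall : ∀ᶠ z in 𝓝 z₀, ∀ c, V c ∈ T c z := eventually_all.2 fun c => hopen c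
  filter_upwards [hall, hRev] with z hz hzR
  exact ⟨jacobianTri_ne_zero_of_forall_mem T jd hjd0 hz, hzR⟩

/-- **The triangular chart is continuous IN THE ENVIRONMENT at the base point** under (O) (level `j < K`, `α < δ_N`). [cite: Balaban1987RG1, (2.10) p.267; BourbakiGT1, Ch. I §10 no. 2, Thm 1 Cor. 5] -/
theorem continuousAt_triChart_env_of_openness (hj : j < K) {α : ℝ} (hαδ : α < deltaSU (Fin N))
    (hT : ∀ c U, T c U = (fun g => (avOfRecord F N K j).avg (Function.update U (centralBond c) g) c) ''
        {g : SU N | ∀ i : Idx (F.P K), dist1 (fibreFamily U c (pre U c * g * post U c) i) ≤ α})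
    (hleft : ∀ c U g, (∀ i : Idx (F.P K), dist1 (fibreFamily U c (pre U c * g * post U c) i) ≤ α) →
        ϑ c U ((avOfRecord F N K j).avg (Function.update U (centralBond c) g) c) = g)
    {V : PBond (F.P K) (j + 1) → SU N} {z₀ : GaugeField (F.P K) j (SU N)}
    (hopen : ∀ c, {z : GaugeField (F.P K) j (SU N) | V c ∈ T c z} ∈ 𝓝 z₀) :
    ContinuousAt (fun z : GaugeField (F.P K) j (SU N) => (extend centralBond (fun c => ϑ c z (V c)) z : GaugeField (F.P K) j (SU N))) z₀ :=
  ((continuousOn_triChart_of_leftInverse_record hj hαδ T ϑ hT hleft).comp (continuous_const.prodMk continuous_id).continuousOn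
    (fun z (hz : z ∈ {z : GaugeField (F.P K) j (SU N) | ∀ c, V c ∈ T c z}) => hz)).continuousAt (eventually_all.2 fun c => hopen c)

/-! ## §2  The two base-point sockets for the re-based chart with a general fallback `σ` and support set `R` -/

variable (R : Set (GaugeField (F.P K) j (SU N))) (σ : (PBond (F.P K) (j + 1) → SU N) → GaugeField (F.P K) j (SU N))

/-- ★★ **`hΦc` FROM OPENNESS**: under (O) at `z₀ = σ V`, (P) and (R′) (the triangular chart stays in `R` near `σ V`), the tower chart `Φ′ = A.piecewise Φ_tri (σ ∘ fst)` is
continuous in the environment at `σ V`: near `σ V` it IS `Φ_tri(V, ·)` (§1), continuous there by FILE 2 (`α < δ_N`, `hT`, `hleft`).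
[cite: Balaban1987RG1, (2.10) p.267 and (2.3) p.265; BourbakiGT1, Ch. I §10 no. 2, Thm 1 Cor. 5] -/
theorem towerChart_continuousAt_of_openness (hj : j < K) {α : ℝ} (hαδ : α < deltaSU (Fin N))
    (hT : ∀ c U, T c U = (fun g => (avOfRecord F N K j).avg (Function.update U (centralBond c) g) c) ''
        {g : SU N | ∀ i : Idx (F.P K), dist1 (fibreFamily U c (pre U c * g * post U c) i) ≤ α})
    (hleft : ∀ c U g, (∀ i : Idx (F.P K), dist1 (fibreFamily U c (pre U c * g * post U c) i) ≤ α) →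
        ϑ c U ((avOfRecord F N K j).avg (Function.update U (centralBond c) g) c) = g)
    (hjd0 : ∀ c z v, v ∈ T c z → jd c z v ≠ 0)
    [DecidablePred (· ∈ {p : (PBond (F.P K) (j + 1) → SU N) × GaugeField (F.P K) j (SU N) |
      {q : (PBond (F.P K) (j + 1) → SU N) × GaugeField (F.P K) j (SU N) | ∀ c, q.1 c ∈ T c q.2}.indicator
          (fun q => ∏ c, jd c q.2 (q.1 c)) p ≠ 0 ∧
        (extend centralBond (fun c => ϑ c p.2 (p.1 c)) p.2 : GaugeField (F.P K) j (SU N)) ∈ R})]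
    {V : PBond (F.P K) (j + 1) → SU N} (hopen : ∀ c, {z : GaugeField (F.P K) j (SU N) | V c ∈ T c z} ∈ 𝓝 (σ V))
    (hRev : ∀ᶠ z in 𝓝 (σ V), (extend centralBond (fun c => ϑ c z (V c)) z : GaugeField (F.P K) j (SU N)) ∈ R) :
    ContinuousAt (fun z => {p : (PBond (F.P K) (j + 1) → SU N) × GaugeField (F.P K) j (SU N) |
        {q : (PBond (F.P K) (j + 1) → SU N) × GaugeField (F.P K) j (SU N) | ∀ c, q.1 c ∈ T c q.2}.indicator
            (fun q => ∏ c, jd c q.2 (q.1 c)) p ≠ 0 ∧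
          (extend centralBond (fun c => ϑ c p.2 (p.1 c)) p.2 : GaugeField (F.P K) j (SU N)) ∈ R}.piecewise
        (fun p => (extend centralBond (fun c => ϑ c p.2 (p.1 c)) p.2 : GaugeField (F.P K) j (SU N))) (fun p => σ p.1) (V, z)) (σ V) := by
  have hA := rebaseSection_mem_nhds_of_openness T ϑ jd hjd0 R hopen hRev
  have heq : (fun z => {p : (PBond (F.P K) (j + 1) → SU N) × GaugeField (F.P K) j (SU N) |
        {q : (PBond (F.P K) (j + 1) → SU N) × GaugeField (F.P K) j (SU N) | ∀ c, q.1 c ∈ T c q.2}.indicator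
            (fun q => ∏ c, jd c q.2 (q.1 c)) p ≠ 0 ∧
          (extend centralBond (fun c => ϑ c p.2 (p.1 c)) p.2 : GaugeField (F.P K) j (SU N)) ∈ R}.piecewise
        (fun p => (extend centralBond (fun c => ϑ c p.2 (p.1 c)) p.2 : GaugeField (F.P K) j (SU N))) (fun p => σ p.1) (V, z)) =ᶠ[𝓝 (σ V)]
      fun z => (extend centralBond (fun c => ϑ c z (V c)) z : GaugeField (F.P K) j (SU N)) := by
    filter_upwards [hA] with z hz
    exact towerChart_eq_of_mem T ϑ jd R σ hz
  exact (continuousAt_triChart_env_of_openness T ϑ hj hαδ hT hleft hopen).congr heq.symm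

omit [NeZero N] in
/-- ★★ **`hJpos` FROM OPENNESS**: under (O) at `z₀ = σ V`, (P) and (R′), the tower Jacobian `J′ = A.indicator J_tri` is POSITIVE near `σ V` (there `J′ = J_tri = ∏_c jd_c ≠ 0`).
No continuity is used. [cite: Balaban1987RG1, (2.10) p.267 and (2.3) p.265 (bookkeeping)] -/
theorem towerJacobian_eventually_pos_of_openness (hjd0 : ∀ c z v, v ∈ T c z → jd c z v ≠ 0)
    {V : PBond (F.P K) (j + 1) → SU N} (hopen : ∀ c, {z : GaugeField (F.P K) j (SU N) | V c ∈ T c z} ∈ 𝓝 (σ V))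
    (hRev : ∀ᶠ z in 𝓝 (σ V), (extend centralBond (fun c => ϑ c z (V c)) z : GaugeField (F.P K) j (SU N)) ∈ R) :
    ∀ᶠ z in 𝓝 (σ V), 0 < Set.indicator {p : (PBond (F.P K) (j + 1) → SU N) × GaugeField (F.P K) j (SU N) |
        {q : (PBond (F.P K) (j + 1) → SU N) × GaugeField (F.P K) j (SU N) | ∀ c, q.1 c ∈ T c q.2}.indicator
            (fun q => ∏ c, jd c q.2 (q.1 c)) p ≠ 0 ∧
          (extend centralBond (fun c => ϑ c p.2 (p.1 c)) p.2 : GaugeField (F.P K) j (SU N)) ∈ R}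
      ({q : (PBond (F.P K) (j + 1) → SU N) × GaugeField (F.P K) j (SU N) | ∀ c, q.1 c ∈ T c q.2}.indicator fun q => ∏ c, jd c q.2 (q.1 c)) (V, z) := by
  filter_upwards [rebaseSection_mem_nhds_of_openness T ϑ jd hjd0 R hopen hRev] with z hz
  exact indicator_pos_of_mem_of_ne_zero hz hz.1

/-! ## §3  At the record: (R′) from the RIGHT-INVERSE clause and `0 < ε₁`; the tower's `hΦc` and `hJpos` sockets in the binder shapes VERBATIM -/

/-- ★ **(R′) AT THE RECORD: ALONG THE TRIANGULAR CHART, `χ^{(2.9)}_j ≠ 0` NEAR THE CRITICAL CONFIGURATION.**  Level `j < K`, `α < δ_N`, `0 < ε₁`, `V` solvable with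
`V ∈ domAlt_{j+1}`; per-bond data with the image-window clause `hT`, the LEFT-inverse clause `hleft` and the RIGHT-inverse clause `hright` (all three are clauses of
`exists_perBondCharts_of_forwardLaws`); (O) parametric openness at `V^{(j)}(V)` and (P).  Then for `z` near `V^{(j)}(V)`: every image window contains `V c` ((O)), so `J_tri(V,z) ≠ 0`
((P)) and the chart lies over `V` (`avOfRecord_triChart_eq_of_jacobian_ne_zero`, from `hright`), so each fluctuation variable of `Φ_tri(V,z)` reads `dist1 (V^{(j)}(V)(b)⁻¹ · Φ_tri(V,z)(b))`
(`fluctDevOfRecord_eq_of_avg_eq`) — continuous in `z` at `V^{(j)}(V)` (FILE 2) with value `dist1 1 = 0 < ε₁` there (dag-n09-w5's `triChart_critCfg_eq`); finitely many bonds.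
[cite: Balaban1987RG1, (2.9) p.266, (2.10) p.267 and (2.3)–(2.4) pp.265–266; Balaban1985Averaging, Prop. 2 (53) p.26; BourbakiGT1, Ch. I §10 no. 2, Thm 1 Cor. 5] -/
theorem eventually_chiFixed29_triChart_ne_zero_of_openness (ν : Stage7Numerics) {ε₁ : ℝ} (hε₁ : 0 < ε₁) (g : ℕ → ℝ) (hj : j < K) {α : ℝ}
    (hαδ : α < deltaSU (Fin N))
    (hT : ∀ c U, T c U = (fun g => (avOfRecord F N K j).avg (Function.update U (centralBond c) g) c) ''
        {g : SU N | ∀ i : Idx (F.P K), dist1 (fibreFamily U c (pre U c * g * post U c) i) ≤ α})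
    (hleft : ∀ c U g, (∀ i : Idx (F.P K), dist1 (fibreFamily U c (pre U c * g * post U c) i) ≤ α) →
        ϑ c U ((avOfRecord F N K j).avg (Function.update U (centralBond c) g) c) = g)
    (hright : ∀ c U, ∀ v ∈ T c U, (avOfRecord F N K j).avg (Function.update U (centralBond c) (ϑ c U v)) c = v)
    (hjd0 : ∀ c z v, v ∈ T c z → jd c z v ≠ 0)
    (hεreg : 0 < ν.εreg) (hε3 : (143 * (((((F.P K).d + 4 : ℕ) : ℝ)) ^ 2 / 4) ^ 2) * ν.εreg ≤ 1 / 3)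
    (hε2 : 2 * ν.εreg ≤ 2 * deltaSU (Fin N) / ((((F.P K).d + 4) * (F.P K).L : ℕ) : ℝ) ^ 2)
    (hα : ((((F.P K).d + 2) * (F.P K).L : ℕ) : ℝ) ^ 2 / 4 * (2 * ν.εreg / ((F.P K).L : ℝ) ^ 2) ≤ α)
    {V : PBond (F.P K) (j + 1) → SU N} (hsol : UkExists F N K (j + 1) ν.εreg V)
    (hopen : ∀ c, {z : GaugeField (F.P K) j (SU N) | V c ∈ T c z} ∈ 𝓝 (critCfgOfRecord F N ν K j V)) :
    ∀ᶠ z in 𝓝 (critCfgOfRecord F N ν K j V),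
      (extend centralBond (fun c => ϑ c z (V c)) z : GaugeField (F.P K) j (SU N)) ∈ {U : GaugeField (F.P K) j (SU N) | chiFixed29 F N ν ε₁ K g j U ≠ 0} := by
  have hbase := triChart_critCfg_eq ϑ ν hj hleft hεreg hε3 hε2 hα hsol
  have hall : ∀ᶠ z in 𝓝 (critCfgOfRecord F N ν K j V), ∀ c, V c ∈ T c z := eventually_all.2 fun c => hopen c
  -- over `V` near the base point
  have havg : ∀ᶠ z in 𝓝 (critCfgOfRecord F N ν K j V),
      (avOfRecord F N K j).avg (extend centralBond (fun c => ϑ c z (V c)) z : GaugeField (F.P K) j (SU N)) = V := by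
    filter_upwards [hall] with z hz
    exact avOfRecord_triChart_eq_of_jacobian_ne_zero T ϑ jd hj hright (jacobianTri_ne_zero_of_forall_mem T jd hjd0 hz)
  -- each frozen-reference deviation is continuous at the base point with value `0 < ε₁`
  have hcont := continuousAt_triChart_env_of_openness T ϑ hj hαδ hT hleft hopen
  have hdev : ∀ b : PBond (F.P K) j, ∀ᶠ z in 𝓝 (critCfgOfRecord F N ν K j V),
      dist1 ((critCfgOfRecord F N ν K j V b)⁻¹ * (extend centralBond (fun c => ϑ c z (V c)) z : GaugeField (F.P K) j (SU N)) b) < ε₁ := by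
    intro b
    have hb : ContinuousAt (fun z : GaugeField (F.P K) j (SU N) =>
        dist1 ((critCfgOfRecord F N ν K j V b)⁻¹ * (extend centralBond (fun c => ϑ c z (V c)) z : GaugeField (F.P K) j (SU N)) b)) (critCfgOfRecord F N ν K j V) :=
      B12ContinuousTransportInvarianceOn.continuous_dist1_SU.continuousAt.comp (continuousAt_const.mul (((continuous_apply b).continuousAt).comp hcont))
    have h0 : dist1 ((critCfgOfRecord F N ν K j V b)⁻¹ *
        (extend centralBond (fun c => ϑ c (critCfgOfRecord F N ν K j V) (V c)) (critCfgOfRecord F N ν K j V) : GaugeField (F.P K) j (SU N)) b) < ε₁ := by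
      rw [hbase, inv_mul_cancel, GaugeGroup.dist1_one]
      exact hε₁
    exact hb.eventually_mem (Iio_mem_nhds h0)
  have hdev' : ∀ᶠ z in 𝓝 (critCfgOfRecord F N ν K j V), ∀ b : PBond (F.P K) j,
      dist1 ((critCfgOfRecord F N ν K j V b)⁻¹ * (extend centralBond (fun c => ϑ c z (V c)) z : GaugeField (F.P K) j (SU N)) b) < ε₁ :=
    eventually_all.2 hdev
  filter_upwards [havg, hdev'] with z hzavg hzdev
  have h1 : chiFix29OfRecord F N ν ε₁ K j (extend centralBond (fun c => ϑ c z (V c)) z : GaugeField (F.P K) j (SU N)) = 1 := by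
    refine (chiFix29OfRecord_eq_one_iff ν ε₁ K j _).2 fun b _ => ?_
    rw [fluctDevOfRecord_eq_of_avg_eq ν hzavg b]
    exact hzdev b
  show chiFix29OfRecord F N ν ε₁ K j (extend centralBond (fun c => ϑ c z (V c)) z : GaugeField (F.P K) j (SU N)) ≠ 0
  rw [h1]
  exact one_ne_zero

/-- ★★★ **SOCKET `hΦc` OF THE ROAD-A′ TOWER AT LEVEL `j`, BINDER SHAPE VERBATIM, FROM (O) AND (P)**: for every `V ∈ domAlt_{j+1}`, the tower chart `Φ′` of
`…N09TowerChartOfPerBondCharts[AtRecord]` is continuous in the fine field at the critical configuration `V^{(j)}(V)` — given (O) parametric openness of the image windows at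
`V^{(j)}(V)` (the implicit-function face; dag-n09-w4 g5's C^ω one-bond chart reads ∕ global forward law are its natural supplier), (P) non-vanishing inverse densities on the image
windows, the three clauses `hT hleft hright` of the per-bond inversions (`α < δ_N`), `0 < ε₁`, [B11]-existence `hsolν` and the [B7]-numerics.  CONDITIONAL; nothing of Bałaban's
asserted. [cite: Balaban1987RG1, (2.3)–(2.4) pp.265–266, (2.9)–(2.10) pp.266–267 and (0.4) p.253; Balaban1985Averaging, Prop. 2 (53) p.26; BourbakiGT1, Ch. I §10 no. 2, Thm 1 Cor. 5] -/
theorem tower_hΦc_of_openness_of_hsolν_of_numerics (ν : Stage7Numerics) {ε₁ : ℝ} (hε₁ : 0 < ε₁) (g : ℕ → ℝ) (hj : j < K) {α : ℝ} (hαδ : α < deltaSU (Fin N))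
    (hT : ∀ c U, T c U = (fun g => (avOfRecord F N K j).avg (Function.update U (centralBond c) g) c) ''
        {g : SU N | ∀ i : Idx (F.P K), dist1 (fibreFamily U c (pre U c * g * post U c) i) ≤ α})
    (hleft : ∀ c U g, (∀ i : Idx (F.P K), dist1 (fibreFamily U c (pre U c * g * post U c) i) ≤ α) →
        ϑ c U ((avOfRecord F N K j).avg (Function.update U (centralBond c) g) c) = g)
    (hright : ∀ c U, ∀ v ∈ T c U, (avOfRecord F N K j).avg (Function.update U (centralBond c) (ϑ c U v)) c = v)
    (hjd0 : ∀ c z v, v ∈ T c z → jd c z v ≠ 0)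
    (hopen : ∀ V ∈ domAltOfRecord F N ν K (j + 1), ∀ c, {z : GaugeField (F.P K) j (SU N) | V c ∈ T c z} ∈ 𝓝 (critCfgOfRecord F N ν K j V))
    (hεreg : 0 < ν.εreg) (hε3 : (143 * (((((F.P K).d + 4 : ℕ) : ℝ)) ^ 2 / 4) ^ 2) * ν.εreg ≤ 1 / 3)
    (hε2 : 2 * ν.εreg ≤ 2 * deltaSU (Fin N) / ((((F.P K).d + 4) * (F.P K).L : ℕ) : ℝ) ^ 2)
    (hα : ((((F.P K).d + 2) * (F.P K).L : ℕ) : ℝ) ^ 2 / 4 * (2 * ν.εreg / ((F.P K).L : ℝ) ^ 2) ≤ α)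
    (hsolν : ∀ j < K, ∀ W ∈ domAltOfRecord F N ν K (j + 1), UkExists F N K (j + 1) ν.εreg W)
    [DecidablePred (· ∈ {p : (PBond (F.P K) (j + 1) → SU N) × GaugeField (F.P K) j (SU N) |
      {q : (PBond (F.P K) (j + 1) → SU N) × GaugeField (F.P K) j (SU N) | ∀ c, q.1 c ∈ T c q.2}.indicator
          (fun q => ∏ c, jd c q.2 (q.1 c)) p ≠ 0 ∧
        (extend centralBond (fun c => ϑ c p.2 (p.1 c)) p.2 : GaugeField (F.P K) j (SU N)) ∈
          {U : GaugeField (F.P K) j (SU N) | chiFixed29 F N ν ε₁ K g j U ≠ 0}})] :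
    ∀ V ∈ domAltOfRecord F N ν K (j + 1),
      ContinuousAt (fun z => (Set.piecewise {p : ((PBond (F.P K) (j + 1) → SU N) × GaugeField (F.P K) j (SU N)) |
          ({q : ((PBond (F.P K) (j + 1) → SU N) × GaugeField (F.P K) j (SU N)) | ∀ c, q.1 c ∈ T c q.2}.indicator fun q => ∏ c, jd c q.2 (q.1 c)) p ≠ 0 ∧
            (extend centralBond (fun c => ϑ c p.2 (p.1 c)) p.2 : GaugeField (F.P K) j (SU N)) ∈
              {U : GaugeField (F.P K) j (SU N) | chiFixed29 F N ν ε₁ K g j U ≠ 0}}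
        (fun p => (extend centralBond (fun c => ϑ c p.2 (p.1 c)) p.2 : GaugeField (F.P K) j (SU N)))
        (fun p => critCfgOfRecord F N ν K j p.1)) (V, z)) (critCfgOfRecord F N ν K j V) := by
  intro V hV
  exact towerChart_continuousAt_of_openness T ϑ jd {U : GaugeField (F.P K) j (SU N) | chiFixed29 F N ν ε₁ K g j U ≠ 0}
    (fun W => critCfgOfRecord F N ν K j W) hj hαδ hT hleft hjd0 (hopen V hV)
    (eventually_chiFixed29_triChart_ne_zero_of_openness T ϑ jd ν hε₁ g hj hαδ hT hleft hright hjd0 hεreg hε3 hε2 hα (hsolν j hj V hV) (hopen V hV))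

/-- ★★★ **SOCKET `hJpos` OF THE ROAD-A′ TOWER AT LEVEL `j`, BINDER SHAPE VERBATIM, FROM (O) AND (P)**: for every `V ∈ domAlt_{j+1}`, the tower Jacobian `J′` is positive in a
neighbourhood of the critical configuration `V^{(j)}(V)`.  CONDITIONAL as above; nothing of Bałaban's asserted.
[cite: Balaban1987RG1, (2.3)–(2.4) pp.265–266, (2.9)–(2.10) pp.266–267 and (0.4) p.253; Balaban1985Averaging, Prop. 2 (53) p.26; BourbakiGT1, Ch. I §10 no. 2, Thm 1 Cor. 5] -/
theorem tower_hJpos_of_openness_of_hsolν_of_numerics (ν : Stage7Numerics) {ε₁ : ℝ} (hε₁ : 0 < ε₁) (g : ℕ → ℝ) (hj : j < K) {α : ℝ} (hαδ : α < deltaSU (Fin N))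
    (hT : ∀ c U, T c U = (fun g => (avOfRecord F N K j).avg (Function.update U (centralBond c) g) c) ''
        {g : SU N | ∀ i : Idx (F.P K), dist1 (fibreFamily U c (pre U c * g * post U c) i) ≤ α})
    (hleft : ∀ c U g, (∀ i : Idx (F.P K), dist1 (fibreFamily U c (pre U c * g * post U c) i) ≤ α) →
        ϑ c U ((avOfRecord F N K j).avg (Function.update U (centralBond c) g) c) = g)
    (hright : ∀ c U, ∀ v ∈ T c U, (avOfRecord F N K j).avg (Function.update U (centralBond c) (ϑ c U v)) c = v)
    (hjd0 : ∀ c z v, v ∈ T c z → jd c z v ≠ 0)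
    (hopen : ∀ V ∈ domAltOfRecord F N ν K (j + 1), ∀ c, {z : GaugeField (F.P K) j (SU N) | V c ∈ T c z} ∈ 𝓝 (critCfgOfRecord F N ν K j V))
    (hεreg : 0 < ν.εreg) (hε3 : (143 * (((((F.P K).d + 4 : ℕ) : ℝ)) ^ 2 / 4) ^ 2) * ν.εreg ≤ 1 / 3)
    (hε2 : 2 * ν.εreg ≤ 2 * deltaSU (Fin N) / ((((F.P K).d + 4) * (F.P K).L : ℕ) : ℝ) ^ 2)
    (hα : ((((F.P K).d + 2) * (F.P K).L : ℕ) : ℝ) ^ 2 / 4 * (2 * ν.εreg / ((F.P K).L : ℝ) ^ 2) ≤ α)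
    (hsolν : ∀ j < K, ∀ W ∈ domAltOfRecord F N ν K (j + 1), UkExists F N K (j + 1) ν.εreg W) :
    ∀ V ∈ domAltOfRecord F N ν K (j + 1),
      ∀ᶠ z in 𝓝 (critCfgOfRecord F N ν K j V), 0 < (Set.indicator {p : ((PBond (F.P K) (j + 1) → SU N) × GaugeField (F.P K) j (SU N)) |
          ({q : ((PBond (F.P K) (j + 1) → SU N) × GaugeField (F.P K) j (SU N)) | ∀ c, q.1 c ∈ T c q.2}.indicator fun q => ∏ c, jd c q.2 (q.1 c)) p ≠ 0 ∧
            (extend centralBond (fun c => ϑ c p.2 (p.1 c)) p.2 : GaugeField (F.P K) j (SU N)) ∈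
              {U : GaugeField (F.P K) j (SU N) | chiFixed29 F N ν ε₁ K g j U ≠ 0}}
        ({q : ((PBond (F.P K) (j + 1) → SU N) × GaugeField (F.P K) j (SU N)) | ∀ c, q.1 c ∈ T c q.2}.indicator fun q => ∏ c, jd c q.2 (q.1 c))) (V, z) := by
  intro V hV
  exact towerJacobian_eventually_pos_of_openness T ϑ jd {U : GaugeField (F.P K) j (SU N) | chiFixed29 F N ν ε₁ K g j U ≠ 0}
    (fun W => critCfgOfRecord F N ν K j W) hjd0 (hopen V hV)
    (eventually_chiFixed29_triChart_ne_zero_of_openness T ϑ jd ν hε₁ g hj hαδ hT hleft hright hjd0 hεreg hε3 hε2 hα (hsolν j hj V hV) (hopen V hV))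

end Summit.QuantumFields.YangMills.BalabanUVNodes.N09TowerBasePointSocketsOfOpenness

end
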